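import Summits.QuantumFields.BalabanUV.T4Continuum.Spine.NE1p.TiltedMeanInfluence
import Mathlib.MeasureTheory.Integral.Pi

/-!
# T⁴ programme, spine estimate NE1′ (node O3b/H2) — the DECOUPLED N-SLOT MODEL: gen 3's four shapes jointly inhabited, the two
# OLD budgets holding BY THE MECHANISM (centring ⇒ second order) with ratio `θ₁²Λ`, and `tiltedMeanMatching_of_budget` firing

Cell `pub-balaban-gaps` (YM blitz Y1, track G2), seat `ne1` gen 4 (prover-pub-balaban-gaps-ne1-g4-0), record `HOME/ne/NE1.md` §4
row R35 (gen 4).  ADDITIVE — imports the seat's gen-4 `TiltedMeanInfluence` (hence gen 3's `TiltedMeanCrossover` and gen 2's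
`DressedMGFForm`) and `Mathlib.MeasureTheory.Integral.Pi` ONLY; modifies nothing; NO definitions (the model is given by explicit
hypotheses).

WHAT THIS IS.  Gen 3's §4 sanity instance of `TiltedMeanCrossover` had ONE slot under Dirac laws.  Here the four hypothesis shapes
of the crossover booking — `ScaleLedger`, `OldInfluenceBudget` for run A and for run B, `YoungInfluenceRate` — are inhabited by a
genuine measure-theoretic object with MANY slots at all scales: for every number of steps `K` the field space is `D → S` (one
coordinate per slot `X : D`, `D` finite), run A's class law is the PRODUCT `⊗_X κA K X` of probability laws, run B's is
`⊗_X κB K X`, and the observable is the total `x ↦ Σ_X h K X (x X)` of bounded measurable slot contributions (one class, no bad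
classes).  Then:
* §0 `tiltedMean_pi_sum` — EXACT DECOUPLING for finitely many slots: `tiltedMean (Σ_X h_X) (⊗_X κ_X) s = Σ_X tiltedMean h_X κ_X s`
  (Fubini on the finite product, Mathlib `integral_fintype_prod_eq_prod`), each term `≤ a_X²|s|` when centred
  (`tiltedMean_pi_eq_sum_of_centred`);
* `scaleLedger_pi` — the SCALE LEDGER holds BY CONSTRUCTION (`tiltedMean_pi_sum`): both runs' tilted means are `0 + Σ_X Δ X`
  with `ΔA K t τ s X = tiltedMean (h K X) (κA K X) s`, `ΔB` likewise, base width `0`;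
* `oldInfluenceBudget_pi` — if a run's slot laws CENTRE the contributions (`∫ h K X dκ K X = 0`), the amplitudes are
  `|h K X| ≤ amp K X ≤ c₁·θ₁^{K − sc K X}` and the scale-`j` slots number at most `vol·Λ^{K−j}`, then that run's `OldInfluenceBudget`
  holds with size `2·l₀·c₁²` and ratio `θ₁²·Λ` — by gen 4's `abs_tiltedMean_le_of_centred` (second order on the whole tilt window) and
  `oldInfluenceBudget_of_amplitudes`, i.e. BY THE MECHANISM of NE1.md R28 (3), not by fiat;
* `tiltedMeanMatching_pi` — with the young rate ASSUMED for the pair (`YoungInfluenceRate`, row NE5∕NE9's content, no mechanism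
  offered here) gen 3's `tiltedMeanMatching_of_budget` returns `TiltedMeanMatching … (crossoverEta vol (2l₀c₁²) (2l₀c₁²) C (θ₁²Λ) θ Λ′ 0)`,
  summable for `0 < θ₁²Λ < 1`, `0 < θ < 1`, `θ ≤ Λ′` (`summable_crossoverEta`) — e.g. `θ₁ = L⁻³`, `Λ = L⁴` in `d = 4`
  (`TiltedMeanInfluence.secondOrder_lt_one_lt_firstOrder`).

HONEST FRAMING.  A PRODUCT-LAW MODEL ([folklore] measure theory + the seat's earlier bookkeeping); it is NOT Bałaban's
class-conditioned law (there decoupling is the cluster expansion of [B13] §§1–2, and the slot census is NODE O's object); nothing of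
his is asserted or instantiated.  NE1′ NOT proved; spine 0∕9; (B) 0∕13; one fixed finite T⁴ — NOT ℝ⁴, NOT infinite volume, NOT a mass
gap, NOT Clay.  0 sorry.
-/

noncomputable section

open Finset MeasureTheory ProbabilityTheory
open scoped BigOperators

namespace Summit.QuantumFields.BalabanUV.T4Continuum.NE1p.TiltedMeanInfluenceModel

open Summit.QuantumFields.BalabanUV.T4Continuum.NE1p.DressedMGFForm (tiltedMean TiltedMeanMatching)
open Summit.QuantumFields.BalabanUV.T4Continuum.NE1p.TiltedMeanCrossover
  (ScaleLedger OldInfluenceBudget YoungInfluenceRate crossoverEta tiltedMeanMatching_of_budget summable_crossoverEta)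
open Summit.QuantumFields.BalabanUV.T4Continuum.NE1p.TiltedMeanInfluence
open Literature.MathematicalPhysics.QuantumFieldTheory.Balaban1983to89

/-! ## §0 Finitely many decoupled slots: the tilted mean of `Σ_X h_X` under `⊗_X κ_X` is the sum of the slots' own tilted means

The N-slot form of `TiltedMeanInfluence` §2: in the exactly-decoupled model the decomposition clause of gen 3's `ScaleLedger` holds BY CONSTRUCTION with
the slot terms `Δ X = tiltedMean h_X κ_X s` (run by run), each of which `TiltedMeanInfluence` §1 prices at `≤ a_X²·|s|` when centred — so the shape costs
nothing and the budget is `TiltedMeanInfluence` §4's squared-amplitude ledger. -/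

section Product

variable {D : Type*} [Fintype D] [DecidableEq D] {S : D → Type*} [∀ i, MeasurableSpace (S i)]
  {κ : ∀ i, Measure (S i)} [∀ i, IsProbabilityMeasure (κ i)] {h : ∀ i, S i → ℝ} {a : D → ℝ}

/-- **EXACT DECOUPLING, FINITELY MANY SLOTS.**  Probability laws `κ_X` on the slot spaces `S_X`, bounded measurable slot
contributions `h_X` (`|h_X| ≤ a_X`).  Under the product law `⊗_X κ_X` the tilted mean of the total `x ↦ Σ_X h_X (x X)` is the
sum of the slots' own tilted means at the same tilt: `tiltedMean (Σ_X h_X) (⊗_X κ_X) s = Σ_X tiltedMean h_X κ_X s` (Fubini on the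
finite product, Mathlib `integral_fintype_prod_eq_prod`). [folklore] -/
theorem tiltedMean_pi_sum (hhm : ∀ i, Measurable (h i)) (hh : ∀ i x, |h i x| ≤ a i) (s : ℝ) :
    tiltedMean (fun x : ∀ i, S i => ∑ i, h i (x i)) (Measure.pi κ) s = ∑ i, tiltedMean (h i) (κ i) s := by
  have hZ : ∀ i, 0 < ∫ y, Real.exp (s * h i y) ∂κ i := fun i =>
    T4GenFunBounds.mgf_pos_of_abs_le (hhm i).aemeasurable (ae_of_all _ (hh i)) s
  have hexp : ∀ x : ∀ i, S i, Real.exp (s * ∑ i, h i (x i)) = ∏ i, Real.exp (s * h i (x i)) := fun x => by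
    rw [mul_sum, Real.exp_sum]
  -- the factors of the `i`-th numerator term and their integrability
  have hint : ∀ i k, Integrable (fun y => (if k = i then h k y else 1) * Real.exp (s * h k y)) (κ k) := by
    intro i k
    by_cases hk : k = i
    · simp only [if_pos hk]
      exact integrable_mul_exp_mul (hhm k) (hh k) s
    · simp only [if_neg hk, one_mul]
      exact T4GenFunBounds.integrable_exp_mul_of_bound (hhm k).aemeasurable (ae_of_all _ (hh k)) s
  have hpt : ∀ i (x : ∀ k, S k), h i (x i) * Real.exp (s * ∑ k, h k (x k))
      = ∏ k, ((if k = i then h k (x k) else 1) * Real.exp (s * h k (x k))) := fun i x => by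
    rw [prod_mul_distrib, prod_ite_eq' univ i (fun k => h k (x k)), if_pos (mem_univ i), hexp]
  -- denominator and the `i`-th numerator term as products of one-slot integrals
  have hden : ∫ x, Real.exp (s * ∑ i, h i (x i)) ∂Measure.pi κ = ∏ i, ∫ y, Real.exp (s * h i y) ∂κ i := by
    simp_rw [hexp]
    exact integral_fintype_prod_eq_prod (fun i y => Real.exp (s * h i y))
  have hnum_i : ∀ i, ∫ x, h i (x i) * Real.exp (s * ∑ k, h k (x k)) ∂Measure.pi κ
      = (∫ y, h i y * Real.exp (s * h i y) ∂κ i) * ∏ k ∈ univ.erase i, ∫ y, Real.exp (s * h k y) ∂κ k := by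
    intro i
    simp_rw [hpt i]
    rw [integral_fintype_prod_eq_prod (fun k y => (if k = i then h k y else 1) * Real.exp (s * h k y)),
      ← mul_prod_erase univ _ (mem_univ i)]
    congr 1
    · exact integral_congr_ae (ae_of_all _ fun y => by beta_reduce; rw [if_pos rfl])
    · exact prod_congr rfl fun k hk =>
        integral_congr_ae (ae_of_all _ fun y => by beta_reduce; rw [if_neg (ne_of_mem_erase hk), one_mul])
  have hnum : ∫ x, (∑ i, h i (x i)) * Real.exp (s * ∑ k, h k (x k)) ∂Measure.pi κ
      = ∑ i, (∫ y, h i y * Real.exp (s * h i y) ∂κ i) * ∏ k ∈ univ.erase i, ∫ y, Real.exp (s * h k y) ∂κ k := by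
    simp_rw [sum_mul]
    rw [integral_finsetSum _ fun i _ => ?_]
    · exact sum_congr rfl fun i _ => hnum_i i
    · rw [show (fun x : ∀ k, S k => h i (x i) * Real.exp (s * ∑ k, h k (x k)))
          = fun x => ∏ k, ((if k = i then h k (x k) else 1) * Real.exp (s * h k (x k))) from funext (hpt i)]
      exact Integrable.fintype_prod_dep (hint i)
  rw [tiltedMean_eq_div, hnum, hden, sum_div]
  refine sum_congr rfl fun i _ => ?_
  rw [tiltedMean_eq_div, ← mul_prod_erase univ (fun k => ∫ y, Real.exp (s * h k y) ∂κ k) (mem_univ i),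
    mul_div_mul_right _ _ (prod_pos fun k _ => hZ k).ne']

/-- **THE DECOUPLED LEDGER IS SECOND ORDER, RUN BY RUN.**  In the N-slot decoupled model with CENTRED slot contributions
(`∫h_X dκ_X = 0`, `|h_X| ≤ a_X`) the tilted mean of the total is `Σ_X Δ_X` with `|Δ_X| ≤ a_X²·|s|` for every slot and every tilt
— the one-run influence data of gen 3's `ScaleLedger` ∕ `OldInfluenceBudget`, priced by `abs_tiltedMean_le_of_centred` with no hypothesis beyond centring and
boundedness. [folklore] -/
theorem tiltedMean_pi_eq_sum_of_centred (hhm : ∀ i, Measurable (h i)) (hh : ∀ i x, |h i x| ≤ a i)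
    (h0 : ∀ i, ∫ y, h i y ∂κ i = 0) (s : ℝ) :
    tiltedMean (fun x : ∀ i, S i => ∑ i, h i (x i)) (Measure.pi κ) s = ∑ i, tiltedMean (h i) (κ i) s ∧
      ∀ i, |tiltedMean (h i) (κ i) s| ≤ a i ^ 2 * |s| :=
  ⟨tiltedMean_pi_sum hhm hh s, fun i => abs_tiltedMean_le_of_centred (hhm i) (hh i) (h0 i) s⟩

end Product

/-! ## §1 The model: gen 3's four shapes on product laws -/

section Model

variable {D S : Type*} [Fintype D] [DecidableEq D] [MeasurableSpace S]
  {κA κB : ℕ → D → Measure S} [∀ K X, IsProbabilityMeasure (κA K X)] [∀ K X, IsProbabilityMeasure (κB K X)]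
  {h : ℕ → D → S → ℝ} {amp : ℕ → D → ℝ} {sc : ℕ → D → ℕ} {l₀ : ℝ}

/-- **THE SCALE LEDGER OF THE DECOUPLED MODEL HOLDS BY CONSTRUCTION.**  One class `()`, no bad classes, ledger = all slots with
scales `sc K X ≤ K`; both runs' tilted means of the total `Σ_X h K X (x X)` under the product laws are `0 + Σ_X` (the slot's own
tilted mean) — gen 4's `tiltedMean_pi_sum` — and the base widths are `0`. [folklore] -/
theorem scaleLedger_pi (hmeas : ∀ K X, Measurable (h K X)) (hbound : ∀ K X y, |h K X y| ≤ amp K X)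
    (hsc : ∀ K X, sc K X ≤ K) :
    ScaleLedger (ι := Unit) (Ω := fun _ => D → S) (Ω' := fun _ => D → S) l₀ (fun _ => {()}) (fun _ _ => ∅)
      (fun K x => ∑ X, h K X (x X)) (fun K _ => Measure.pi (κA K))
      (fun K x => ∑ X, h K X (x X)) (fun K _ => Measure.pi (κB K))
      (fun _ _ => univ) sc (fun _ _ _ _ => 0) (fun _ _ _ _ => 0)
      (fun K _ _ s X => tiltedMean (h K X) (κA K X) s) (fun K _ _ s X => tiltedMean (h K X) (κB K X) s) (fun _ => 0) := by
  intro K t _ τ _ s _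
  refine ⟨fun X _ => hsc K X, ?_, ?_, by simp⟩
  · rw [zero_add]; exact tiltedMean_pi_sum (κ := κA K) (hmeas K) (hbound K) s
  · rw [zero_add]; exact tiltedMean_pi_sum (κ := κB K) (hmeas K) (hbound K) s

omit [Fintype D] [DecidableEq D] [∀ K X, IsProbabilityMeasure (κB K X)] in
/-- **A RUN'S OLD BUDGET HOLDS BY THE MECHANISM.**  If run A's slot laws CENTRE the contributions (`∫ h K X dκA K X = 0`), the
amplitudes satisfy `|h K X| ≤ amp K X`, `0 ≤ amp K X ≤ c₁·θ₁^{K − sc K X}`, and there are at most `vol·Λ^{K−j}` slots of scale `j` in the ledger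
`wf K τ`, then `OldInfluenceBudget l₀ T Bad wf sc ΔA vol (2·l₀·c₁²) (θ₁²·Λ)` for the influence data
`ΔA K t τ s X = tiltedMean (h K X) (κA K X) s` — second order on the whole tilt window (gen 4 `abs_tiltedMean_le_of_centred`) booked by
`oldInfluenceBudget_of_amplitudes`.  Any finite `κA K X`, any class structure. [folklore] -/
theorem oldInfluenceBudget_pi {ι : Type*} [DecidableEq ι] {T : ℕ → Finset ι} {Bad : ℕ → ℝ → Finset ι}
    {wf : ℕ → ι → Finset D} {vol c₁ θ₁ Λ : ℝ} {κ : ℕ → D → Measure S} [∀ K X, IsFiniteMeasure (κ K X)]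
    (hmeas : ∀ K X, Measurable (h K X)) (hbound : ∀ K X y, |h K X y| ≤ amp K X)
    (hcent : ∀ K X, ∫ y, h K X y ∂κ K X = 0) (hamp : ∀ K X, 0 ≤ amp K X ∧ amp K X ≤ c₁ * θ₁ ^ (K - sc K X))
    (hcount : ∀ K (τ : ι), ∀ j ≤ K, (((wf K τ).filter fun X => sc K X = j).card : ℝ) ≤ vol * Λ ^ (K - j)) :
    OldInfluenceBudget l₀ T Bad wf sc (fun K _ _ s X => tiltedMean (h K X) (κ K X) s) vol (2 * l₀ * c₁ ^ 2)
      (θ₁ ^ 2 * Λ) := by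
  refine oldInfluenceBudget_of_amplitudes (amp := amp) (fun K t _ τ _ s _ X _ => ?_)
    (fun K τ X _ => hamp K X) hcount
  calc |tiltedMean (h K X) (κ K X) s| ≤ amp K X ^ 2 * |s| := abs_tiltedMean_le_of_centred (hmeas K X) (hbound K X) (hcent K X) s
    _ ≤ 2 * |s| * amp K X ^ 2 := by nlinarith [abs_nonneg s, sq_nonneg (amp K X)]

/-- **`tiltedMeanMatching_of_budget` FIRES ON THE MODEL.**  Both runs centred with the amplitude∕count census of
`oldInfluenceBudget_pi` (ratio `a = θ₁²Λ`), and the young rate ASSUMED for the pair of influence families (row NE5∕NE9's content —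
no mechanism is offered for it here): the two product-law runs satisfy
`TiltedMeanMatching l₀ … (crossoverEta vol (2l₀c₁²) (2l₀c₁²) C (θ₁²Λ) θ Λ′ 0)`. [folklore] -/
theorem tiltedMeanMatching_pi {vol c₁ θ₁ Λ C θ Λ' : ℝ}
    (hmeas : ∀ K X, Measurable (h K X)) (hbound : ∀ K X y, |h K X y| ≤ amp K X) (hsc : ∀ K X, sc K X ≤ K)
    (hcentA : ∀ K X, ∫ y, h K X y ∂κA K X = 0) (hcentB : ∀ K X, ∫ y, h K X y ∂κB K X = 0)
    (hamp : ∀ K X, 0 ≤ amp K X ∧ amp K X ≤ c₁ * θ₁ ^ (K - sc K X))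
    (hcount : ∀ K, ∀ j ≤ K, (((univ : Finset D).filter fun X => sc K X = j).card : ℝ) ≤ vol * Λ ^ (K - j))
    (hY : YoungInfluenceRate (ι := Unit) l₀ (fun _ => {()}) (fun _ _ => ∅) (fun _ _ => univ) sc
      (fun K _ _ s X => tiltedMean (h K X) (κA K X) s) (fun K _ _ s X => tiltedMean (h K X) (κB K X) s) vol C θ Λ')
    (hvol : 0 ≤ vol) (hθ₁ : 0 ≤ θ₁ ^ 2 * Λ) (hθ : 0 ≤ θ) (hΛ' : 0 ≤ Λ') :
    TiltedMeanMatching (ι := Unit) (Ω := fun _ => D → S) (Ω' := fun _ => D → S) l₀ (fun _ => {()}) (fun _ _ => ∅)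
      (fun K x => ∑ X, h K X (x X)) (fun K _ => Measure.pi (κA K))
      (fun K x => ∑ X, h K X (x X)) (fun K _ => Measure.pi (κB K))
      (crossoverEta vol (2 * l₀ * c₁ ^ 2) (2 * l₀ * c₁ ^ 2) C (θ₁ ^ 2 * Λ) θ Λ' fun _ => 0) :=
  tiltedMeanMatching_of_budget (scaleLedger_pi hmeas hbound hsc)
    (oldInfluenceBudget_pi (T := fun _ => {()}) (Bad := fun _ _ => ∅) (wf := fun _ _ => univ)
      hmeas hbound hcentA hamp fun K _ => hcount K)
    (oldInfluenceBudget_pi (T := fun _ => {()}) (Bad := fun _ _ => ∅) (wf := fun _ _ => univ)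
      hmeas hbound hcentB hamp fun K _ => hcount K)
    hY hvol hθ₁ hθ hΛ'

/-- … and the majorant is SUMMABLE when the second-order ratio and the young rate are in the open unit interval
(`0 < θ₁²Λ < 1`, `0 < θ < 1`, `θ ≤ Λ′`; gen 3 `summable_crossoverEta`) — in `d = 4` with `θ₁ = L⁻³`, `Λ = L⁴`, `L > 1` the ratio is
`L⁻² < 1` (`TiltedMeanInfluence.secondOrder_lt_one_lt_firstOrder`). [folklore] -/
theorem summable_crossoverEta_pi {vol c₁ θ₁ Λ C θ Λ' : ℝ} (h0 : 0 < θ₁ ^ 2 * Λ) (h1 : θ₁ ^ 2 * Λ < 1)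
    (hθ : 0 < θ) (hθ1 : θ < 1) (hθΛ : θ ≤ Λ') :
    Summable (crossoverEta vol (2 * l₀ * c₁ ^ 2) (2 * l₀ * c₁ ^ 2) C (θ₁ ^ 2 * Λ) θ Λ' fun _ => 0) :=
  summable_crossoverEta h0 h1 hθ hθ1 hθΛ summable_zero

end Model

end Summit.QuantumFields.BalabanUV.T4Continuum.NE1p.TiltedMeanInfluenceModel

end
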